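import Literature.AlgebraicGeometry.Motives.WeilFormOrthogonalFrame
import HarnessLib

/-!
# A Weil form with a Rosati-symmetric `K`-antilinear operator `j`, `j² = b` (Albert type II,
# `D = K ⊕ Kj = (-d, b)_ℚ`): `j`-adapted orthogonal `K`-bases and `det H = (-b)ⁿ`

Family `hodge`, layer `Literature/AlgebraicGeometry/Motives`; THEOREMS ONLY (no definition, no named
fact, no `sorry`; D-0026). Companion of `Motives/WeilDiscriminant` (van Geemen's Hermitian form
`H(x, y) = E(x, α y) + α E(x, y)` = `weilHermitianForm E α` of a `ℚ`-bilinear form `E` on a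
`K`-vector space `V`, `K = ℚ + ℚ α`, `α² = -d < 0`, and `det H ∈ ℚˣ ⧸ Nm(Kˣ)` = `weilDiscriminant E α`),
of `Motives/WeilDiscriminantSplit` (the SPLIT case: a `K`-Lagrangian subspace forces
`det H = [(-1)ⁿ]`, Deligne–Milne Cor. 4.2) and of `Motives/WeilFormOrthogonalFrame` (Gram–Schmidt over
`K`). This file treats the TYPE-II case: besides `K = ℚ(α)` the form carries a second operator `j`,
`ℚ`-linear and `K`-ANTILINEAR (`j(α x) = -α j(x)`), with `j² = b ∈ ℚˣ` and ROSATI-SYMMETRIC for `E`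
(`E(j x, y) = E(x, j y)`), so that `D = K ⊕ K j` with `x j = j x̄` for `x ∈ K` is the quaternion
algebra `(-d, b)_ℚ` — van Geemen–Verra, *Quaternionic Pryms and Hodge classes*, Topology 42 (2003),
proof of Lemma 4.5 (held text `paper:arxiv-math_0103111` p. 9, verbatim): "there is a `j ∈ F` such
that `F = K ⊕ Kj` and `xj = j x̄` for `x ∈ K`. Hence the eigenspaces of `x` are permuted by the action
of `j`"; for an abelian variety `A` with `D ⊂ End⁰(A)` and a polarization whose Rosati involution
induces `x ↦ x̄` on `K` and fixes `j`, positivity of the Rosati involution forces `b > 0`, i.e. `D`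
INDEFINITE (Albert type II; Mumford, *Abelian Varieties* §21, Birkenhake–Lange §5.5).

## What is proved (everything; 0 sorry)

For `E` alternating of Weil type (`E(α x, α y) = d E(x, y)`) and `j` as above (`b ≠ 0`):

* §1 identities (private helpers: `E(j x, j y) = b E(x, y)`, `E(x, j x) = 0`, `E(j x, α x) = 0`,
  `H(j x, x) = 0`, `H(j x, y) = 0 → H(x, j y) = 0`, `H(x, y) = 0 → H(j x, j y) = 0`); exported:
  **`H(x, j x) = 0`** (`weilHermitianForm_self_j`), **`H(j x, j y) = -b · H(y, x)`**
  (`= -b · conj H(x, y)`: `j` is a conjugate-linear similitude of multiplier `-b`,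
  `weilHermitianForm_j_j`), and `Q(j x) = -b Q(x)` for `Q(x) = E(x, α x) = H(x, x)` (`weilQ_j`).
* §2 `linearIndependent_of_weilOrthogonal`: pairwise `H`-orthogonal vectors with `Q ≠ 0` are
  `K`-linearly independent.
* §3 **`exists_typeII_orthogonalFrame`** — THE STRUCTURE LEMMA: if `E` is non-degenerate, `V` has a
  `K`-basis `x₁, …, xₘ, j x₁, …, j xₘ`, pairwise `H`-orthogonal, with `Q(xᵢ) = aᵢ ≠ 0` and
  `Q(j xᵢ) = -b aᵢ` — i.e. `(V, H)` is the orthogonal sum of the `m` `j`-stable planes `K xᵢ ⊕ K j xᵢ` with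
  Gram matrices `diag(aᵢ, -b aᵢ)`; in particular `dim_K V = 2m` is EVEN (`even_finrank_of_typeII`).
  Proof (strong induction on `dim_K V`): a non-zero non-degenerate `V` has `x` with `Q(x) ≠ 0`; by §1
  the plane `K x ⊕ K j x` has Gram matrix `diag(Q x, -b Q x)`, the `K`-linear map
  `(H(x, ·), H(j x, ·)) : V → K²` is onto, its kernel `W` (`dim W = dim V - 2`) is `j`-stable and again
  non-degenerate, and one recurses on `W`.
* §4 **`weilDiscriminant_eq_of_typeII`**: for `dim_K V = 2n`, **`det H = [(-b)ⁿ] ∈ ℚˣ ⧸ Nm(Kˣ)`**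
  (`det diag(aᵢ, -b aᵢ) = (-b)ⁿ (Π aᵢ)²` and squares are norms); `weilDiscriminant_eq_of_typeII_of_odd`
  (`n` odd: `det H = [-b]`), `weilDiscriminant_eq_one_of_typeII_of_even` (`n` even: `det H` trivial),
  and the `ℚˣ`-valued spelling `weilDiscriminant_eq_mk_of_typeII`.

CONSEQUENCE recorded (not a theorem of this file): on a polarized abelian `2n`-fold of Weil type
`(X, K, E)` whose endomorphism algebra contains such a `j` — an indefinite quaternion algebra
`D = K ⊕ Kj ∋ √-d` with `j` Rosati-symmetric, `j² = b > 0` — van Geemen's invariant is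
`det H = (-b)ⁿ`; for `n` EVEN this is the trivial class (the split class `[(-1)ⁿ]`), for `n` ODD it is
`[-b]`, so the discriminant class of the Weil structure determines `D = (-d, -δ₀)_ℚ` up to isomorphism.
The converse (a model with prescribed `b` in every odd rank) is the sibling `WeilDiscriminantTypeIIModel`.

Hypotheses on `(K, α, σ)` as in the sibling files: `α² = -d`, `d > 0`, `K = ℚ + ℚ α`, and — only where
the basis-free discriminant is computed in a basis (`discrClass_eq_of_basis`) — the conjugation `σ`
(`σ α = -α`, `k σ(k) = Nm(k)`).

## References

* [vanGeemenVerra2003QuaternionicPryms] B. van Geemen, A. Verra, Quaternionic Pryms and Hodge classes,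
  Topology 42 (2003) 35–53, Lemma 4.5 and its proof (`F = K ⊕ Kj`, `xj = j x̄`).
* [vanGeemen1994HodgeAV] B. van Geemen, An introduction to the Hodge conjecture for abelian varieties,
  LNM 1594 (1994), Lemma 5.2 (2)–(3), 4.14, 5.4 and (5.4.1) (`det H ∈ ℚ^*/Nm(K^*)`).
* [MoonenZarhin1999LowDim] B. Moonen, Yu. Zarhin, Hodge classes on abelian varieties of low dimension,
  Math. Ann. 315 (1999) 711–733, §2 (types II/III with `K ⊂ D` carry Weil structures).
* [MumfordAV1970] D. Mumford, Abelian Varieties (1970), §21 (positivity of the Rosati involution; Albert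
  types).
-/

noncomputable section

open Module

namespace Literature.AlgebraicGeometry.Motives

universe u

/-! ### §1 Identities for a Rosati-symmetric antilinear `j` with `j² = b` -/

section Identities

variable {K : Type*} [Field K] [Algebra ℚ K] {α : K} {d b : ℚ}
  {V : Type*} [AddCommGroup V] [Module ℚ V] [Module K V]

/-- `E(j x, j y) = b E(x, y)`: a Rosati-symmetric `j` with `j² = b` is an `E`-similitude of multiplier
`b` (`E(j x, j y) = E(x, j(j y)) = E(x, b y)`). [folklore] -/
private theorem apply_j_j (E : LinearMap.BilinForm ℚ V) (j : V →ₗ[ℚ] V) (hjj : ∀ x, j (j x) = b • x)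
    (hjE : ∀ x y, E (j x) y = E x (j y)) (x y : V) : E (j x) (j y) = b * E x y := by
  rw [hjE, hjj, LinearMap.map_smul, smul_eq_mul]

/-- `E(x, j x) = 0`: from `E(j x, j(j x)) = b E(x, j x)` and `E(j x, b x) = -b E(x, j x)` (`E`
alternating, `b ≠ 0`). [folklore] -/
private theorem apply_self_j (E : LinearMap.BilinForm ℚ V) (hE : ∀ x y : V, E y x = -E x y) (j : V →ₗ[ℚ] V)
    (hb : b ≠ 0) (hjj : ∀ x, j (j x) = b • x) (hjE : ∀ x y, E (j x) y = E x (j y)) (x : V) :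
    E x (j x) = 0 := by
  have h1 : E (j x) (j (j x)) = b * E x (j x) := apply_j_j E j hjj hjE x (j x)
  have h2 : E (j x) (j (j x)) = -(b * E x (j x)) := by
    rw [hjj, LinearMap.map_smul, smul_eq_mul, hE x (j x), mul_neg]
  have h3 : 2 * b * E x (j x) = 0 := by linarith
  simpa [hb] using h3

variable [IsScalarTower ℚ K V]

/-- `E(j x, α x) = 0`: `E(j x, α x) = E(x, j(α x)) = -E(x, α j x) = -E(j x, α x)` (antilinearity of
`j` and the symmetry of `(u, v) ↦ E(u, α v)`). [folklore] -/
private theorem apply_j_smul_self (E : LinearMap.BilinForm ℚ V) (hd : d ≠ 0) (hα : α * α = algebraMap ℚ K (-d))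
    (hE : ∀ x y : V, E y x = -E x y) (hW : ∀ x y : V, E (α • x) (α • y) = d * E x y)
    (j : V →ₗ[ℚ] V) (hjα : ∀ x, j (α • x) = -(α • j x)) (hjE : ∀ x y, E (j x) y = E x (j y))
    (x : V) : E (j x) (α • x) = 0 := by
  have h1 : E (j x) (α • x) = -E x (α • j x) := by
    rw [hjE, hjα, map_neg]
  have h2 : E x (α • j x) = E (j x) (α • x) :=
    apply_smul_comm_of_weil E hd hα (fun u v => hE v u) hW (j x) x
  rw [h2] at h1
  linarith

/-- **`H(x, j x) = 0`**: `x` and `j x` are `H`-orthogonal for van Geemen's Hermitian form — the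
first half of "the plane `K x ⊕ K j x` has Gram matrix `diag(Q x, -b Q x)`" (elementary; the setting
`F = K ⊕ Kj`, `xj = j x̄` is van Geemen–Verra's, the form `H` is van Geemen's Lemma 5.2 (2)).
[cite: vanGeemenVerra2003QuaternionicPryms, Lemma 4.5 (proof)] [cite: vanGeemen1994HodgeAV, Lemma 5.2 (2)] -/
theorem weilHermitianForm_self_j (E : LinearMap.BilinForm ℚ V) (hd : d ≠ 0)
    (hα : α * α = algebraMap ℚ K (-d)) (hE : ∀ x y : V, E y x = -E x y)
    (hW : ∀ x y : V, E (α • x) (α • y) = d * E x y) (j : V →ₗ[ℚ] V) (hb : b ≠ 0)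
    (hjα : ∀ x, j (α • x) = -(α • j x)) (hjj : ∀ x, j (j x) = b • x)
    (hjE : ∀ x y, E (j x) y = E x (j y)) (x : V) : weilHermitianForm E α x (j x) = 0 := by
  have h1 : E x (α • j x) = 0 := by
    rw [apply_smul_comm_of_weil E hd hα (fun u v => hE v u) hW (j x) x]
    exact apply_j_smul_self E hd hα hE hW j hjα hjE x
  rw [weilHermitianForm_apply, h1, apply_self_j E hE j hb hjj hjE x, map_zero, mul_zero, add_zero]

/-- **`H(j x, x) = 0`**. [folklore] -/
private theorem weilHermitianForm_j_self (E : LinearMap.BilinForm ℚ V) (hd : d ≠ 0)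
    (hα : α * α = algebraMap ℚ K (-d)) (hE : ∀ x y : V, E y x = -E x y)
    (hW : ∀ x y : V, E (α • x) (α • y) = d * E x y) (j : V →ₗ[ℚ] V) (hb : b ≠ 0)
    (hjα : ∀ x, j (α • x) = -(α • j x)) (hjj : ∀ x, j (j x) = b • x)
    (hjE : ∀ x y, E (j x) y = E x (j y)) (x : V) : weilHermitianForm E α (j x) x = 0 := by
  rw [weilHermitianForm_apply, apply_j_smul_self E hd hα hE hW j hjα hjE x, hE x (j x),
    apply_self_j E hE j hb hjj hjE x, neg_zero, map_zero, mul_zero, add_zero]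

/-- **`H(j x, j y) = -b · H(y, x)`** (`= -b · conj H(x, y)`): `j` is a conjugate-linear similitude of
van Geemen's Hermitian form with multiplier `-b` (`E(j x, α j y) = -E(j x, j(α y)) = -b E(x, α y)`,
`E(j x, j y) = b E(x, y)`, and `H(y, x) = E(x, α y) - α E(x, y)`) — the form-level content of
"`xj = j x̄` for `x ∈ K`. Hence the eigenspaces of `x` are permuted by the action of `j`" (van
Geemen–Verra, proof of Lemma 4.5). [cite: vanGeemenVerra2003QuaternionicPryms, Lemma 4.5 (proof)] [cite: vanGeemen1994HodgeAV, Lemma 5.2 (2)] -/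
theorem weilHermitianForm_j_j (E : LinearMap.BilinForm ℚ V) (hd : d ≠ 0)
    (hα : α * α = algebraMap ℚ K (-d)) (hE : ∀ x y : V, E y x = -E x y)
    (hW : ∀ x y : V, E (α • x) (α • y) = d * E x y) (j : V →ₗ[ℚ] V)
    (hjα : ∀ x, j (α • x) = -(α • j x)) (hjj : ∀ x, j (j x) = b • x)
    (hjE : ∀ x y, E (j x) y = E x (j y)) (x y : V) :
    weilHermitianForm E α (j x) (j y) = -algebraMap ℚ K b * weilHermitianForm E α y x := by
  have h1 : E (j x) (α • j y) = -(b * E x (α • y)) := by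
    have : α • j y = -j (α • y) := by rw [hjα, neg_neg]
    rw [this, map_neg, apply_j_j E j hjj hjE]
  rw [weilHermitianForm_apply, h1, apply_j_j E j hjj hjE, weilHermitianForm_swap E hd hα hE hW x y,
    map_neg, map_mul, map_mul]
  ring

omit [Algebra ℚ K] [IsScalarTower ℚ K V] in
/-- `Q(j x) = -b Q(x)` for `Q(x) = E(x, α x)` (`= H(x, x)`): the second half of "the plane
`K x ⊕ K j x` has Gram matrix `diag(Q x, -b Q x)`". [cite: vanGeemenVerra2003QuaternionicPryms, Lemma 4.5 (proof)] [cite: vanGeemen1994HodgeAV, Lemma 5.2 (2)] -/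
theorem weilQ_j (E : LinearMap.BilinForm ℚ V) (j : V →ₗ[ℚ] V) (hjα : ∀ x, j (α • x) = -(α • j x))
    (hjj : ∀ x, j (j x) = b • x) (hjE : ∀ x y, E (j x) y = E x (j y)) (x : V) :
    E (j x) (α • j x) = -(b * E x (α • x)) := by
  have : α • j x = -j (α • x) := by rw [hjα, neg_neg]
  rw [this, map_neg, apply_j_j E j hjj hjE]

/-- `x = j(b⁻¹ j x)`: `j` is invertible with inverse `b⁻¹ j`. [folklore] -/
private theorem eq_j_inv_smul_j (j : V →ₗ[ℚ] V) (hb : b ≠ 0) (hjj : ∀ x, j (j x) = b • x) (x : V) :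
    x = j (b⁻¹ • j x) := by
  rw [LinearMap.map_smul, hjj, smul_smul, inv_mul_cancel₀ hb, one_smul]

/-- `H(x, j y) = 0 → H(y, j x) = 0`… in the form used below: **`H(u, y) = 0` for `u = j x` gives
`H(x, j y) = 0`** (write `x = j(b⁻¹ j x)` and use `H(j x', j y) = -b H(y, x')`). [folklore] -/
private theorem weilHermitianForm_j_right_eq_zero (E : LinearMap.BilinForm ℚ V) (hd : 0 < d)
    (hα : α * α = algebraMap ℚ K (-d)) (hE : ∀ x y : V, E y x = -E x y)
    (hW : ∀ x y : V, E (α • x) (α • y) = d * E x y) (j : V →ₗ[ℚ] V) (hb : b ≠ 0)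
    (hjα : ∀ x, j (α • x) = -(α • j x)) (hjj : ∀ x, j (j x) = b • x)
    (hjE : ∀ x y, E (j x) y = E x (j y)) {x y : V} (h : weilHermitianForm E α (j x) y = 0) :
    weilHermitianForm E α x (j y) = 0 := by
  have h' : weilHermitianForm E α y (b⁻¹ • j x) = 0 := by
    rw [weilHermitianForm_ratSmul_right,
      weilHermitianForm_comm_eq_zero E hd hα (fun u v => hE v u) hW h, mul_zero]
  conv_lhs => rw [eq_j_inv_smul_j j hb hjj x]
  rw [weilHermitianForm_j_j E hd.ne' hα hE hW j hjα hjj hjE, h', mul_zero]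

/-- `H(x, y) = 0 → H(j x, j y) = 0`. [folklore] -/
private theorem weilHermitianForm_j_j_eq_zero (E : LinearMap.BilinForm ℚ V) (hd : 0 < d)
    (hα : α * α = algebraMap ℚ K (-d)) (hE : ∀ x y : V, E y x = -E x y)
    (hW : ∀ x y : V, E (α • x) (α • y) = d * E x y) (j : V →ₗ[ℚ] V)
    (hjα : ∀ x, j (α • x) = -(α • j x)) (hjj : ∀ x, j (j x) = b • x)
    (hjE : ∀ x y, E (j x) y = E x (j y)) {x y : V} (h : weilHermitianForm E α x y = 0) :
    weilHermitianForm E α (j x) (j y) = 0 := by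
  rw [weilHermitianForm_j_j E hd.ne' hα hE hW j hjα hjj hjE,
    weilHermitianForm_comm_eq_zero E hd hα (fun u v => hE v u) hW h, mul_zero]

end Identities

/-! ### §2 Orthogonal anisotropic families are `K`-linearly independent -/

section Independent

variable {K : Type*} [Field K] [Algebra ℚ K] {α : K} {d : ℚ}
  {V : Type*} [AddCommGroup V] [Module ℚ V] [Module K V] [IsScalarTower ℚ K V]

/-- **Pairwise `H`-orthogonal vectors with `Q(vᵢ) ≠ 0` are `K`-linearly independent**: apply the
`K`-linear functional `H(vᵢ, ·)` to a relation `Σ cₖ vₖ = 0` to get `cᵢ Q(vᵢ) = 0` (the step implicit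
in "there exists a `K`-basis of `V` on which `H` is given by" a diagonal form, van Geemen 5.4).
[cite: vanGeemen1994HodgeAV, Lemma 5.2 (2) and 5.4] -/
theorem linearIndependent_of_weilOrthogonal (E : LinearMap.BilinForm ℚ V)
    (hα : α * α = algebraMap ℚ K (-d))
    (hK : ∀ k : K, ∃ a c : ℚ, k = algebraMap ℚ K a + algebraMap ℚ K c * α)
    (hE : ∀ x y : V, E y x = -E x y) {ι : Type*} {v : ι → V}
    (horth : ∀ p q, p ≠ q → weilHermitianForm E α (v p) (v q) = 0)
    (hQ : ∀ p, E (v p) (α • v p) ≠ 0) : LinearIndependent K v := by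
  classical
  rw [linearIndependent_iff']
  intro s c hs p hp
  obtain ⟨f, hf⟩ := exists_linearMap_eq_weilHermitianForm E hα hK (v p)
  have h0 : f (∑ q ∈ s, c q • v q) = 0 := by rw [hs, map_zero]
  rw [map_sum] at h0
  simp_rw [map_smul, smul_eq_mul, hf] at h0
  rw [Finset.sum_eq_single p (fun q _ hqp => by rw [horth p q (Ne.symm hqp), mul_zero])
    (fun h => absurd hp h), weilHermitianForm_self E (fun x y => hE y x)] at h0
  rcases mul_eq_zero.1 h0 with h | h
  · exact h
  · exact absurd ((map_eq_zero_iff _ (algebraMap ℚ K).injective).1 h) (hQ p)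

end Independent

/-! ### §3 The structure lemma: a `j`-adapted orthogonal `K`-basis -/

section Frame

variable {K : Type*} [Field K] [Algebra ℚ K] {α : K} {d b : ℚ}

/-- **Structure lemma for a Weil form with a type-II operator.** Let `E` be an alternating,
NON-DEGENERATE `ℚ`-bilinear form of Weil type (`E(α x, α y) = d E(x, y)`) on a finite-dimensional
`K`-vector space `V` (`K = ℚ + ℚ α`, `α² = -d < 0`), and `j` a `ℚ`-linear, `K`-antilinear
(`j(α x) = -α j(x)`) operator with `j² = b ≠ 0` which is Rosati-symmetric (`E(j x, y) = E(x, j y)`).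
Then `dim_K V = 2m` is even and there are `x₁, …, xₘ ∈ V` with `Q(xᵢ) = E(xᵢ, α xᵢ) ≠ 0` such that the
`2m` vectors `xᵢ, j xᵢ` are pairwise `H`-orthogonal (`H(xᵢ, xₗ) = 0 = H(xᵢ, j xₗ)` for `i ≠ l`; the
remaining relations `H(xᵢ, j xᵢ) = 0`, `H(j xᵢ, j xₗ) = -b H(xₗ, xᵢ)` are §1) — so they form a `K`-basis
(§2, §4) in which `H = ⊕ᵢ diag(Q xᵢ, -b Q xᵢ)`: `(V, H)` is an orthogonal sum of `j`-stable planes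
`K xᵢ ⊕ K j xᵢ`. Proof by strong induction on `dim_K V`: pick `x` with `Q(x) ≠ 0` (non-degeneracy), the
`K`-linear map `(H(x, ·), H(j x, ·)) : V → K × K` is onto (values `(Q x, 0)` at `x`, `(0, -b Q x)` at
`j x`), its kernel `W` has `dim W = dim V - 2`, is `j`-stable (§1) and non-degenerate (every `v` is
`k₁ x + k₂ j x + w`), recurse. ELEMENTARY; not verbatim in print — it is the `K`-Hermitian form of the
statement that the `D`-module `V`, `D = K ⊕ Kj` (van Geemen–Verra, proof of Lemma 4.5), with its
`D`-compatible form is an orthogonal sum of `D`-lines, written for van Geemen's `H` (Lemma 5.2 (2)) so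
that `det H` (5.2 (3), 5.4) can be read off. [cite: vanGeemenVerra2003QuaternionicPryms, Lemma 4.5 (proof)]
[cite: vanGeemen1994HodgeAV, Lemma 5.2 (2)–(3) and 5.4] -/
theorem exists_typeII_orthogonalFrame (hd : 0 < d) (hα : α * α = algebraMap ℚ K (-d))
    (hK : ∀ k : K, ∃ a c : ℚ, k = algebraMap ℚ K a + algebraMap ℚ K c * α) (hb : b ≠ 0) (k : ℕ) :
    ∀ (V : Type u) [AddCommGroup V] [Module ℚ V] [Module K V] [IsScalarTower ℚ K V]
      [Module.Finite K V], finrank K V = k →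
    ∀ (E : LinearMap.BilinForm ℚ V), (∀ x y : V, E y x = -E x y) →
      (∀ x y : V, E (α • x) (α • y) = d * E x y) → (∀ y : V, (∀ x, E x y = 0) → y = 0) →
    ∀ (j : V →ₗ[ℚ] V), (∀ x, j (α • x) = -(α • j x)) → (∀ x, j (j x) = b • x) →
      (∀ x y, E (j x) y = E x (j y)) →
      ∃ m : ℕ, k = 2 * m ∧ ∃ e : Fin m → V, (∀ i, E (e i) (α • e i) ≠ 0) ∧
        (∀ i l, i ≠ l → weilHermitianForm E α (e i) (e l) = 0) ∧
        (∀ i l, i ≠ l → weilHermitianForm E α (e i) (j (e l)) = 0) := by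
  induction k using Nat.strong_induction_on with
  | _ k IH =>
  intro V _ _ _ _ _ hV E hE hW hN j hjα hjj hjE
  have hE' : ∀ x y : V, E x y = -E y x := fun x y => hE y x
  by_cases hk : k = 0
  · exact ⟨0, by omega, fun i => Fin.elim0 i, fun i => Fin.elim0 i, fun i => Fin.elim0 i,
      fun i => Fin.elim0 i⟩
  -- a vector with `Q(x) ≠ 0` (non-degeneracy)
  obtain ⟨x, hx⟩ : ∃ x : V, E x (α • x) ≠ 0 := by
    by_contra hQ
    push Not at hQ
    have hpos : 0 < finrank K V := by omega
    obtain ⟨y, hy⟩ := (Module.finrank_pos_iff_exists_ne_zero (R := K) (M := V)).1 hpos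
    exact hy (hN y fun z => apply_eq_zero_of_weilHermitianForm_eq_zero E hd hα
      (weilHermitianForm_eq_zero_of_weilQ_eq_zero E hd hα hE' hW hQ z y))
  have hQx : algebraMap ℚ K (E x (α • x)) ≠ 0 :=
    (map_ne_zero_iff _ (algebraMap ℚ K).injective).2 hx
  have hQjx : algebraMap ℚ K (-(b * E x (α • x))) ≠ 0 :=
    (map_ne_zero_iff _ (algebraMap ℚ K).injective).2 (neg_ne_zero.2 (mul_ne_zero hb hx))
  -- the two functionals `H(x, ·)`, `H(j x, ·)` and their common kernel `W`
  obtain ⟨f₁, hf₁⟩ := exists_linearMap_eq_weilHermitianForm E hα hK x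
  obtain ⟨f₂, hf₂⟩ := exists_linearMap_eq_weilHermitianForm E hα hK (j x)
  have hf₁x : f₁ x = algebraMap ℚ K (E x (α • x)) := by rw [hf₁, weilHermitianForm_self E hE' α x]
  have hf₂x : f₂ x = 0 := by
    rw [hf₂]; exact weilHermitianForm_j_self E hd.ne' hα hE hW j hb hjα hjj hjE x
  have hf₁jx : f₁ (j x) = 0 := by
    rw [hf₁]; exact weilHermitianForm_self_j E hd.ne' hα hE hW j hb hjα hjj hjE x
  have hf₂jx : f₂ (j x) = algebraMap ℚ K (-(b * E x (α • x))) := by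
    rw [hf₂, weilHermitianForm_self E hE' α (j x), weilQ_j E j hjα hjj hjE x]
  set F : V →ₗ[K] K × K := f₁.prod f₂ with hFdef
  have hF : ∀ v, F v = (f₁ v, f₂ v) := fun v => rfl
  have hf₁x0 : f₁ x ≠ 0 := by rwa [hf₁x]
  have hf₂jx0 : f₂ (j x) ≠ 0 := by rwa [hf₂jx]
  set W : Submodule K V := LinearMap.ker F with hWdef
  have hWmem : ∀ {w : V}, w ∈ W ↔
      weilHermitianForm E α x w = 0 ∧ weilHermitianForm E α (j x) w = 0 := by
    intro w
    rw [hWdef, LinearMap.mem_ker, hF, Prod.mk_eq_zero, hf₁, hf₂]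
  have hsurj : Function.Surjective F := by
    intro p
    refine ⟨(p.1 / f₁ x) • x + (p.2 / f₂ (j x)) • j x, ?_⟩
    rw [hF, map_add, map_add, map_smul, map_smul, map_smul, map_smul, hf₂x, hf₁jx, smul_eq_mul,
      smul_eq_mul, smul_eq_mul, smul_eq_mul, mul_zero, mul_zero, add_zero, zero_add,
      div_mul_cancel₀ _ hf₁x0, div_mul_cancel₀ _ hf₂jx0]
  have hWk : 2 + finrank K W = k := by
    have h1 := LinearMap.finrank_range_add_finrank_ker F
    rw [LinearMap.range_eq_top.2 hsurj, finrank_top, Module.finrank_prod, Module.finrank_self, hV] at h1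
    exact h1
  -- `W` is `j`-stable
  have hjW : ∀ w ∈ W, j w ∈ W := fun w hw => by
    rw [hWmem] at hw ⊢
    exact ⟨weilHermitianForm_j_right_eq_zero E hd hα hE hW j hb hjα hjj hjE hw.2,
      weilHermitianForm_j_j_eq_zero E hd hα hE hW j hjα hjj hjE hw.1⟩
  -- the restricted data on `W`
  obtain ⟨E', hE'ap⟩ : ∃ E' : LinearMap.BilinForm ℚ W, ∀ a c : W, E' a c = E (a : V) (c : V) :=
    ⟨E.compl₁₂ (W.subtype.restrictScalars ℚ) (W.subtype.restrictScalars ℚ), fun a c => rfl⟩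
  have hH' : ∀ a c : W, weilHermitianForm E' α a c = weilHermitianForm E α (a : V) (c : V) :=
    fun a c => by
      rw [weilHermitianForm_apply, weilHermitianForm_apply, hE'ap, hE'ap, Submodule.coe_smul]
  let j' : W →ₗ[ℚ] W :=
    { toFun := fun w => ⟨j w, hjW w w.2⟩
      map_add' := fun w w' => by
        ext
        simp only [Submodule.coe_add, map_add]
      map_smul' := fun c w => by
        ext
        simp only [Submodule.coe_smul_of_tower, LinearMap.map_smul_of_tower, RingHom.id_apply] }
  have hj'coe : ∀ w : W, ((j' w : W) : V) = j w := fun w => rfl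
  have hEW : ∀ a c : W, E' c a = -E' a c := fun a c => by rw [hE'ap, hE'ap]; exact hE _ _
  have hWW : ∀ a c : W, E' (α • a) (α • c) = d * E' a c := fun a c => by
    rw [hE'ap, hE'ap, Submodule.coe_smul, Submodule.coe_smul]; exact hW _ _
  have hNW : ∀ c : W, (∀ a : W, E' a c = 0) → c = 0 := by
    intro c hc
    have hcW := hWmem.1 c.2
    have hHc : ∀ v : V, weilHermitianForm E α v c = 0 := by
      intro v
      set w := v - ((f₁ v / f₁ x) • x + (f₂ v / f₂ (j x)) • j x) with hw
      have hwW : w ∈ W := by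
        rw [hWdef, LinearMap.mem_ker, hF, Prod.mk_eq_zero, hw, map_sub, map_sub, map_add, map_add,
          map_smul, map_smul, map_smul, map_smul, hf₂x, hf₁jx, smul_zero, smul_zero, add_zero, zero_add,
          smul_eq_mul, smul_eq_mul, div_mul_cancel₀ _ hf₁x0, div_mul_cancel₀ _ hf₂jx0, sub_self, sub_self]
        exact ⟨rfl, rfl⟩
      have hv : v = (f₁ v / f₁ x) • x + (f₂ v / f₂ (j x)) • j x + w := by rw [hw]; abel
      have h1 : E w (α • (c : V)) = 0 := by
        rw [← neg_eq_zero, ← apply_smul_left_of_weil E hd.ne' hα hW w c]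
        have h := hc ⟨α • w, W.smul_mem α hwW⟩
        rwa [hE'ap] at h
      have h2 : E w (c : V) = 0 := by
        have h := hc ⟨w, hwW⟩
        rwa [hE'ap] at h
      rw [hv, weilHermitianForm_add_left, weilHermitianForm_add_left,
        weilHermitianForm_smul_left_eq_zero E hd hα hK hW hcW.1,
        weilHermitianForm_smul_left_eq_zero E hd hα hK hW hcW.2, zero_add, zero_add,
        weilHermitianForm_apply, h1, h2, map_zero, mul_zero, add_zero]
    have hc0 : (c : V) = 0 := hN c fun v => apply_eq_zero_of_weilHermitianForm_eq_zero E hd hα (hHc v)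
    exact_mod_cast hc0
  have hjαW : ∀ w : W, j' (α • w) = -(α • j' w) := fun w => by
    ext
    rw [hj'coe, Submodule.coe_smul, hjα, Submodule.coe_neg, Submodule.coe_smul, hj'coe]
  have hjjW : ∀ w : W, j' (j' w) = b • w := fun w => by
    ext
    rw [hj'coe, hj'coe, hjj, Submodule.coe_smul_of_tower]
  have hjEW : ∀ a c : W, E' (j' a) c = E' a (j' c) := fun a c => by
    rw [hE'ap, hE'ap, hj'coe, hj'coe]; exact hjE _ _
  -- recurse on `W`
  obtain ⟨m', hm', e', hQ', h2', h3'⟩ :=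
    IH (finrank K W) (by omega) W rfl E' hEW hWW hNW j' hjαW hjjW hjEW
  refine ⟨m' + 1, by omega, Fin.cons x (fun i => ((e' i : W) : V)), ?_, ?_, ?_⟩
  · intro i
    cases i using Fin.cases with
    | zero => rwa [Fin.cons_zero]
    | succ i =>
      rw [Fin.cons_succ]
      have h := hQ' i
      rwa [hE'ap, Submodule.coe_smul] at h
  · intro i l hil
    cases i using Fin.cases with
    | zero =>
      cases l using Fin.cases with
      | zero => exact absurd rfl hil
      | succ l =>
        rw [Fin.cons_zero, Fin.cons_succ]
        exact (hWmem.1 (e' l).2).1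
    | succ i =>
      cases l using Fin.cases with
      | zero =>
        rw [Fin.cons_zero, Fin.cons_succ]
        exact weilHermitianForm_comm_eq_zero E hd hα hE' hW (hWmem.1 (e' i).2).1
      | succ l =>
        rw [Fin.cons_succ, Fin.cons_succ, ← hH']
        exact h2' i l fun h => hil (by rw [h])
  · intro i l hil
    cases i using Fin.cases with
    | zero =>
      cases l using Fin.cases with
      | zero => exact absurd rfl hil
      | succ l =>
        rw [Fin.cons_zero, Fin.cons_succ]
        exact (hWmem.1 (hjW _ (e' l).2)).1
    | succ i =>
      cases l using Fin.cases with
      | zero =>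
        rw [Fin.cons_zero, Fin.cons_succ]
        exact weilHermitianForm_comm_eq_zero E hd hα hE' hW (hWmem.1 (e' i).2).2
      | succ l =>
        rw [Fin.cons_succ, Fin.cons_succ, ← hj'coe, ← hH']
        exact h3' i l fun h => hil (by rw [h])

end Frame

/-! ### §4 The discriminant: `det H = (-b)ⁿ` -/

section Discriminant

variable {K : Type*} [Field K] [Algebra ℚ K] {α : K} {d b : ℚ}
  {V : Type u} [AddCommGroup V] [Module ℚ V] [Module K V] [IsScalarTower ℚ K V] [Module.Finite K V]

/-- **The `K`-dimension of a non-degenerate Weil form with a type-II operator is even** (`V` is a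
module over the quaternion algebra `D = K ⊕ Kj` compatible with the non-degenerate `H`; §3).
[cite: vanGeemenVerra2003QuaternionicPryms, Lemma 4.5 (proof)] [cite: vanGeemen1994HodgeAV, Lemma 5.2 (2)–(3) and 5.4] -/
theorem even_finrank_of_typeII (E : LinearMap.BilinForm ℚ V) (hd : 0 < d)
    (hα : α * α = algebraMap ℚ K (-d))
    (hK : ∀ k : K, ∃ a c : ℚ, k = algebraMap ℚ K a + algebraMap ℚ K c * α)
    (hE : ∀ x y : V, E y x = -E x y) (hW : ∀ x y : V, E (α • x) (α • y) = d * E x y)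
    (hN : E.Nondegenerate) (j : V →ₗ[ℚ] V) (hb : b ≠ 0) (hjα : ∀ x, j (α • x) = -(α • j x))
    (hjj : ∀ x, j (j x) = b • x) (hjE : ∀ x y, E (j x) y = E x (j y)) :
    ∃ n : ℕ, finrank K V = 2 * n := by
  obtain ⟨m, hm, -⟩ := exists_typeII_orthogonalFrame hd hα hK hb (finrank K V) V rfl E hE hW
    (fun y hy => hN.2 y hy) j hjα hjj hjE
  exact ⟨m, hm⟩

/-- **`det H = [(-b)ⁿ] ∈ ℚˣ ⧸ Nm(Kˣ)` for a Weil form of `K`-rank `2n` carrying a type-II operator**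
(`j` `ℚ`-linear, `K`-antilinear, `j² = b ≠ 0`, Rosati-symmetric): in the `j`-adapted orthogonal `K`-basis
`xᵢ, j xᵢ` of §3 the Gram matrix of van Geemen's `H` is `diag(a₁, …, aₙ, -b a₁, …, -b aₙ)`, `aᵢ = Q(xᵢ)`,
with determinant `(-b)ⁿ (Π aᵢ)²`, and `(Π aᵢ)² = Nm(Π aᵢ)` is a norm. The class is computed in this basis
by `discrClass_eq_of_basis` (van Geemen 1994, Lemma 5.2 (3)), which is where the conjugation `σ` of
`K` enters. For an abelian `2n`-fold of Weil type `(X, K, E)` with `D = K ⊕ Kj ⊂ End⁰(X)`, `j`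
Rosati-symmetric, `j² = b`, this is van Geemen's isogeny invariant `det H` (4.14, 5.2 (3)) of the
component of `(X, K, E)`. [cite: vanGeemen1994HodgeAV, Lemma 5.2 (2)–(3) and 4.14]
[cite: vanGeemenVerra2003QuaternionicPryms, Lemma 4.5 (proof)] -/
theorem weilDiscriminant_eq_of_typeII (E : LinearMap.BilinForm ℚ V) (σ : K →+* K) (hd : 0 < d)
    (hα : α * α = algebraMap ℚ K (-d)) (hσα : σ α = -α)
    (hK : ∀ k : K, ∃ a c : ℚ, k = algebraMap ℚ K a + algebraMap ℚ K c * α)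
    (hσ : ∀ k : K, k * σ k = algebraMap ℚ K (Algebra.norm ℚ k))
    (hE : ∀ x y : V, E y x = -E x y) (hW : ∀ x y : V, E (α • x) (α • y) = d * E x y)
    (hN : E.Nondegenerate) (j : V →ₗ[ℚ] V) (hb : b ≠ 0) (hjα : ∀ x, j (α • x) = -(α • j x))
    (hjj : ∀ x, j (j x) = b • x) (hjE : ∀ x y, E (j x) y = E x (j y)) {n : ℕ}
    (hV : finrank K V = 2 * n) :
    weilDiscriminant E α = normResidueClass ℚ (algebraMap ℚ K ((-b) ^ n)) := by
  classical
  have hE' : ∀ x y : V, E x y = -E y x := fun x y => hE y x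
  obtain ⟨m, hm, e, hQ, h2, h3⟩ := exists_typeII_orthogonalFrame hd hα hK hb (finrank K V) V rfl E hE
    hW (fun y hy => hN.2 y hy) j hjα hjj hjE
  obtain rfl : m = n := by omega
  -- the `j`-adapted frame `xᵢ, j xᵢ`
  set v : Fin m ⊕ Fin m → V := Sum.elim e (fun i => j (e i)) with hv
  have horth : ∀ p q, p ≠ q → weilHermitianForm E α (v p) (v q) = 0 := by
    rintro (i | i) (l | l) hpq
    · exact h2 i l fun h => hpq (by rw [h])
    · by_cases hil : i = l
      · subst hil
        exact weilHermitianForm_self_j E hd.ne' hα hE hW j hb hjα hjj hjE (e i)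
      · exact h3 i l hil
    · by_cases hil : i = l
      · subst hil
        exact weilHermitianForm_j_self E hd.ne' hα hE hW j hb hjα hjj hjE (e i)
      · exact weilHermitianForm_comm_eq_zero E hd hα hE' hW (h3 l i (Ne.symm hil))
    · exact weilHermitianForm_j_j_eq_zero E hd hα hE hW j hjα hjj hjE (h2 i l fun h => hpq (by rw [h]))
  have hQv : ∀ p, E (v p) (α • v p) ≠ 0 := by
    rintro (i | i)
    · exact hQ i
    · show E (j (e i)) (α • j (e i)) ≠ 0
      rw [weilQ_j E j hjα hjj hjE]
      exact neg_ne_zero.2 (mul_ne_zero hb (hQ i))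
  have hli : LinearIndependent K v := linearIndependent_of_weilOrthogonal E hα hK hE horth hQv
  have hcard : Fintype.card (Fin m ⊕ Fin m) = finrank K V := by
    rw [Fintype.card_sum, Fintype.card_fin, hV, two_mul]
  let vb : Basis (Fin m ⊕ Fin m) K V := basisOfLinearIndependentOfCardEqFinrank' v hli hcard
  have hvb : ⇑vb = v := coe_basisOfLinearIndependentOfCardEqFinrank' v hli hcard
  -- its Gram matrix is `diag(aᵢ, -b aᵢ)`
  set a : Fin m → ℚ := fun i => E (e i) (α • e i) with ha
  have hdiag : ∀ p, weilHermitianForm E α (v p) (v p) =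
      algebraMap ℚ K (Sum.elim a (fun i => -b * a i) p) := by
    rintro (i | i)
    · rw [weilHermitianForm_self E hE' α]
      rfl
    · rw [weilHermitianForm_self E hE' α]
      show algebraMap ℚ K (E (j (e i)) (α • j (e i))) = algebraMap ℚ K (-b * a i)
      rw [weilQ_j E j hjα hjj hjE, neg_mul]
  have hgram : gramMatrix (weilHermitianForm E α) ⇑vb =
      Matrix.diagonal fun p => algebraMap ℚ K (Sum.elim a (fun i => -b * a i) p) := by
    ext p q
    rw [gramMatrix_apply, hvb, Matrix.diagonal_apply]
    by_cases hpq : p = q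
    · subst hpq
      rw [if_pos rfl, hdiag]
    · rw [if_neg hpq, horth p q hpq]
  have hprod : (∏ p, Sum.elim a (fun i => -b * a i) p) = (∏ i, a i) ^ 2 * (-b) ^ m := by
    rw [Fintype.prod_sum_type]
    simp only [Sum.elim_inl, Sum.elim_inr]
    rw [Finset.prod_mul_distrib, Finset.prod_const, Finset.card_univ, Fintype.card_fin]
    ring
  have hdet : (gramMatrix (weilHermitianForm E α) ⇑vb).det =
      algebraMap ℚ K ((∏ i, a i) ^ 2) * algebraMap ℚ K ((-b) ^ m) := by
    rw [hgram, Matrix.det_diagonal, ← map_prod, hprod, map_mul]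
  -- squares are norms
  have hP : (∏ i, a i) ≠ 0 := Finset.prod_ne_zero_iff.2 fun i _ => hQ i
  set t : Kˣ := Units.mk0 (algebraMap ℚ K (∏ i, a i))
    ((map_ne_zero_iff _ (algebraMap ℚ K).injective).2 hP) with ht
  have hnorm : algebraMap ℚ K (Algebra.norm ℚ (t : K)) = algebraMap ℚ K ((∏ i, a i) ^ 2) := by
    rw [ht, Units.val_mk0, Algebra.norm_algebraMap, finrank_rat_eq_two_of_sq_eq_neg hd hα hK]
  show discrClass ℚ (weilHermitianForm E α) = _
  rw [← weilSesqForm_coe E σ hd.ne' hα hW hσα hK, discrClass_eq_of_basis ℚ hσ _ vb, weilSesqForm_coe,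
    hdet, ← hnorm, normResidueClass_norm_mul]

/-- The same with the class written in `ℚˣ`: `det H = (-b)ⁿ · Nm(Kˣ)`. [cite: vanGeemen1994HodgeAV, Lemma 5.2 (2)–(3) and 4.14] -/
theorem weilDiscriminant_eq_mk_of_typeII (E : LinearMap.BilinForm ℚ V) (σ : K →+* K) (hd : 0 < d)
    (hα : α * α = algebraMap ℚ K (-d)) (hσα : σ α = -α)
    (hK : ∀ k : K, ∃ a c : ℚ, k = algebraMap ℚ K a + algebraMap ℚ K c * α)
    (hσ : ∀ k : K, k * σ k = algebraMap ℚ K (Algebra.norm ℚ k))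
    (hE : ∀ x y : V, E y x = -E x y) (hW : ∀ x y : V, E (α • x) (α • y) = d * E x y)
    (hN : E.Nondegenerate) (j : V →ₗ[ℚ] V) (hb : b ≠ 0) (hjα : ∀ x, j (α • x) = -(α • j x))
    (hjj : ∀ x, j (j x) = b • x) (hjE : ∀ x y, E (j x) y = E x (j y)) {n : ℕ}
    (hV : finrank K V = 2 * n) :
    weilDiscriminant E α =
      (QuotientGroup.mk (Units.mk0 ((-b) ^ n) (pow_ne_zero n (neg_ne_zero.2 hb))) :
        ℚˣ ⧸ normUnitsSubgroup ℚ K) := by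
  rw [weilDiscriminant_eq_of_typeII E σ hd hα hσα hK hσ hE hW hN j hb hjα hjj hjE hV,
    ← normResidueClass_algebraMap, Units.val_mk0]

/-- **Odd rank: `det H = [-b]`.** For `dim_K V = 2n` with `n` ODD (abelian `2n`-folds of Weil type with
`n` odd, e.g. SIXFOLDS), `(-b)ⁿ ≡ -b` modulo squares, so the discriminant class of a Weil structure
carrying a type-II operator with `j² = b` is `[-b]`: the class DETERMINES the quaternion algebra
`D = K ⊕ Kj = (-d, b)_ℚ = (-d, -δ₀)_ℚ` met on that component. [cite: vanGeemen1994HodgeAV, Lemma 5.2 (2)–(3) and 4.14] -/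
theorem weilDiscriminant_eq_of_typeII_of_odd (E : LinearMap.BilinForm ℚ V) (σ : K →+* K) (hd : 0 < d)
    (hα : α * α = algebraMap ℚ K (-d)) (hσα : σ α = -α)
    (hK : ∀ k : K, ∃ a c : ℚ, k = algebraMap ℚ K a + algebraMap ℚ K c * α)
    (hσ : ∀ k : K, k * σ k = algebraMap ℚ K (Algebra.norm ℚ k))
    (hE : ∀ x y : V, E y x = -E x y) (hW : ∀ x y : V, E (α • x) (α • y) = d * E x y)
    (hN : E.Nondegenerate) (j : V →ₗ[ℚ] V) (hb : b ≠ 0) (hjα : ∀ x, j (α • x) = -(α • j x))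
    (hjj : ∀ x, j (j x) = b • x) (hjE : ∀ x y, E (j x) y = E x (j y)) {n : ℕ} (hn : Odd n)
    (hV : finrank K V = 2 * n) :
    weilDiscriminant E α = normResidueClass ℚ (algebraMap ℚ K (-b)) := by
  obtain ⟨k, rfl⟩ := hn
  rw [weilDiscriminant_eq_of_typeII E σ hd hα hσα hK hσ hE hW hN j hb hjα hjj hjE hV]
  set t : Kˣ := Units.mk0 (algebraMap ℚ K ((-b) ^ k))
    ((map_ne_zero_iff _ (algebraMap ℚ K).injective).2 (pow_ne_zero k (neg_ne_zero.2 hb))) with ht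
  have hnorm : algebraMap ℚ K (Algebra.norm ℚ (t : K)) = algebraMap ℚ K (((-b) ^ k) ^ 2) := by
    rw [ht, Units.val_mk0, Algebra.norm_algebraMap, finrank_rat_eq_two_of_sq_eq_neg hd hα hK]
  have hpow : (-b) ^ (2 * k + 1) = ((-b) ^ k) ^ 2 * (-b) := by ring
  rw [hpow, map_mul, ← hnorm, normResidueClass_norm_mul]

/-- **Even rank: `det H` is trivial.** For `dim_K V = 2n` with `n` EVEN (abelian fourfolds, eightfolds
… of Weil type), `(-b)ⁿ` is a square, so a Weil structure carrying a type-II operator has TRIVIAL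
discriminant — the split class `[(-1)ⁿ] = [1]` (Deligne–Milne Cor. 4.2, `Motives/WeilDiscriminantSplit`):
for even `n`, type-II members with `K ⊂ D` occur only on the split component. [cite: vanGeemen1994HodgeAV, Lemma 5.2 (2)–(3) and 4.14] -/
theorem weilDiscriminant_eq_one_of_typeII_of_even (E : LinearMap.BilinForm ℚ V) (σ : K →+* K)
    (hd : 0 < d) (hα : α * α = algebraMap ℚ K (-d)) (hσα : σ α = -α)
    (hK : ∀ k : K, ∃ a c : ℚ, k = algebraMap ℚ K a + algebraMap ℚ K c * α)
    (hσ : ∀ k : K, k * σ k = algebraMap ℚ K (Algebra.norm ℚ k))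
    (hE : ∀ x y : V, E y x = -E x y) (hW : ∀ x y : V, E (α • x) (α • y) = d * E x y)
    (hN : E.Nondegenerate) (j : V →ₗ[ℚ] V) (hb : b ≠ 0) (hjα : ∀ x, j (α • x) = -(α • j x))
    (hjj : ∀ x, j (j x) = b • x) (hjE : ∀ x y, E (j x) y = E x (j y)) {n : ℕ} (hn : Even n)
    (hV : finrank K V = 2 * n) :
    weilDiscriminant E α = 1 := by
  obtain ⟨k, rfl⟩ := hn
  rw [weilDiscriminant_eq_of_typeII E σ hd hα hσα hK hσ hE hW hN j hb hjα hjj hjE hV]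
  set t : Kˣ := Units.mk0 (algebraMap ℚ K ((-b) ^ k))
    ((map_ne_zero_iff _ (algebraMap ℚ K).injective).2 (pow_ne_zero k (neg_ne_zero.2 hb))) with ht
  have hnorm : algebraMap ℚ K (Algebra.norm ℚ (t : K)) = algebraMap ℚ K (((-b) ^ k) ^ 2) := by
    rw [ht, Units.val_mk0, Algebra.norm_algebraMap, finrank_rat_eq_two_of_sq_eq_neg hd hα hK]
  have hpow : (-b) ^ (k + k) = ((-b) ^ k) ^ 2 * 1 := by ring
  rw [hpow, map_mul, ← hnorm, normResidueClass_norm_mul, map_one, ← (algebraMap ℚ K).map_one,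
    ← Units.val_one, normResidueClass_algebraMap, QuotientGroup.mk_one]

end Discriminant

end Literature.AlgebraicGeometry.Motives

end
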